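import Mathlib
import Summits.PneNP.PneNP.Theorems.ClusUniversalCertificateCoordTransfer
import Summits.PneNP.PneNP.Theorems.ClusUniversalCertificateCoordSlice
import Summits.PneNP.PneNP.Theorems.ClusUniversalCertificateCoordInv
import Summits.PneNP.PneNP.Theorems.ClusUniversalCertificateCoordBook
import Summits.PneNP.PneNP.Theorems.ClusUniversalCertificateCoordBookBlk
import Summits.PneNP.PneNP.Theorems.ClusUniversalCertificateCoordBaseTwoBlocks
import Summits.PneNP.PneNP.Theorems.ClusUniversalCertificateCoordBaseOnes
import Summits.PneNP.PneNP.Theorems.ClusUniversalCertificateCoordSliceZeroFree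
import Summits.PneNP.PneNP.Theorems.ClusUniversalCertificateCoordBZP

/-!
# Line `slicing` — crux `UniversalCertAll` (stmt-PneNP-19683), route ClusUniversalCertificate.  RESHAPE 3 (coord form), planner pnp-ideate-p1 g19.

FRONTIER rung F-N1 (restricted-model combinatorics of affine flats in `𝔽₂^M`); nothing here bears on `P` versus `NP`.

HISTORY / HONESTY.  g17's bit-slicing line (mask form, RESHAPE 2 registered 2026-08-29T10:53Z) is the COORDINATE form of this seat's own path
`coord` (g6–g9): its free step `ClusCoord.stub_slice` (p517634), bookkeeping `ClusCoord.stub_cBook` (p518823), invariance `ClusCoord.stub_inv`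
(p517383), block bookkeeping `ClusCoord.stub_cBookBlk` (p520032), transfer `ClusCoord.stub_transfer`, and the bases `ClusCoord.stub_baseTwoBlocks`,
`ClusCoord.stub_baseOnes` (hypercube theorem), `ClusCoord.stub_sliceZeroFreeBlock` are ALL LANDED in `Theorems/ClusUniversalCertificateCoord*.lean`,
and g17's "0-starved" class is `ClusCoord.GZeroRare` (zero-rare in every admissible frame; popular form `ClusCoord.card_block_eq_gt_zcount_of_gZeroRare`).
RESHAPE 3 therefore states the line over the objects of record (`…Theorems.ClusCoord`, p516754 / p519312) instead of re-typing them: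

* `stub_reduce` (TRUE, size S/M, for a bench prover): the crux in every total dimension follows from the mixed certificate on the HARD CORE —
  zero-rare, ≥ 3 nonempty blocks, some block of size ≥ 2, every nonempty block has a zero — given the certificate in all smaller total dimensions.
  Proof = the strong induction of `ClusCoord.ucMixDim_all_peel` run with the landed theorems: not zero-rare ⇒ free coordinate step
  (`stub_slice` + `stub_cBook` + IH, pulled back by `stub_inv`); ≤ 2 nonempty blocks ⇒ `stub_baseTwoBlocks`; all blocks of size ≤ 1 ⇒ `stub_baseOnes`;
  a nonempty zero-free block ⇒ `stub_sliceZeroFreeBlock` + `stub_cBookBlk` + IH (`card_filter_ne_lt`); otherwise the core hypothesis.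
* `stub_core` (OPEN, load-bearing): the mixed certificate `UCMix` on the hard core with the strong induction hypothesis — the crux restricted to the
  only class no landed theorem or free step reaches.  Brief for both: `Lines/slicing-brief.md`; card `Lines/slicing.md`.

Both stub statements are spelled out over LANDED constants only (`UCMixDim`, `UCMix`, `GZeroRare`, `bsize`, `zcount`), so a prover's Theorems file
can state them verbatim after `open Summit.PneNP.PneNP.Theorems.ClusCoord` with no new definitions.
-/

set_option linter.dupNamespace false

namespace Summit.PneNP.PneNP.Cruxes.UniversalCertAll.Slicing

open Finset
open Summit.PneNP.PneNP.Theorems.ClusCoord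

/-- **stub_reduce** (TRUE; S/M).  The mixed certificate in every total dimension follows from the CORE STEP.  [the peel induction of
`ClusCoord.ucMixDim_all_peel` with h₁ := `ClusCoord.stub_cBook`, h₂ := `ClusCoord.stub_slice`, h₄ := `ClusCoord.stub_inv`, h₅ := `ClusCoord.stub_cBookBlk`,
bases `ClusCoord.ucMixDim_zero`, `ClusCoord.stub_baseTwoBlocks`, `ClusCoord.stub_baseOnes`, zero-free block via `ClusCoord.stub_sliceZeroFreeBlock`] -/
theorem stub_reduce :
    (∀ M : ℕ, (∀ M' : ℕ, M' < M → UCMixDim M') →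
      ∀ (n : ℕ) (blk : Fin M → Fin n) (Y : Finset (Fin M → ZMod 2)),
        GZeroRare blk Y → 2 < (univ.filter fun j : Fin n => 0 < bsize blk j).card → (∃ j : Fin n, 1 < bsize blk j) →
        (∀ j : Fin n, 0 < bsize blk j → 0 < zcount blk j Y) → UCMix M n blk Y) →
    ∀ M : ℕ, UCMixDim M := by
  sorry

/-- **stub_core** (OPEN, load-bearing = the crux on its hard core).  In total dimension `M`, given the mixed certificate in every smaller total
dimension: every ZERO-RARE `Y ⊆ 𝔽₂^M` (`GZeroRare`: `0` strictly the rarest value of every block in every admissible frame) with at least three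
nonempty blocks, some block of size `≥ 2` and a zero in every nonempty block satisfies the mixed certificate `UCMix M n blk Y`.
Why it might fail to be EASIER than the crux: the core is not small ((2,2): thousands of zero-rare sets incl. near-products), and the cell's structured
step rules on it (layer families `stub_peelZeroRare*`, integral block layering `IBL`, affine sections) are either refuted as explicit rules or open;
no counterexample to `UCMix` itself is known (exhaustive (n,m) ≤ (3,2),(2,3); sampled to (6,2),(3,3),(2,4)). -/
theorem stub_core :
    ∀ M : ℕ, (∀ M' : ℕ, M' < M → UCMixDim M') →
      ∀ (n : ℕ) (blk : Fin M → Fin n) (Y : Finset (Fin M → ZMod 2)),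
        GZeroRare blk Y → 2 < (univ.filter fun j : Fin n => 0 < bsize blk j).card → (∃ j : Fin n, 1 < bsize blk j) →
        (∀ j : Fin n, 0 < bsize blk j → 0 < zcount blk j Y) → UCMix M n blk Y := by
  sorry

/-- The composition: the ONLY theorem of this file concluding the crux by name. -/
theorem UniversalCertAll_of : Summit.PneNP.PneNP.Theses.ClusUniversalCertificate.UniversalCertAll :=
  stub_transfer (stub_reduce stub_core)

end Summit.PneNP.PneNP.Cruxes.UniversalCertAll.Slicing
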